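import Literature.NumberTheory.LFunctions.SimpleZeros
import Literature.NumberTheory.LFunctions.VinogradovKorobovFarZerosTail
import HarnessLib

/-!
# RH-FREE — Zeros of `ζ` of a given multiplicity: Simonič–Trudgian–Turnage-Butterbaugh's explicit density `N_j(T) ≤ 1.014 e^{−6.459·10⁻⁷ j} N(T)` («nothing here bears on the truth of RH»)

Topic `Literature/NumberTheory/LFunctions` (RH literature cell, L4 "explicit zero statistics";
companion of `ZeroGapsExplicit.lean`, which types Theorem 1 of the same paper (explicit
Selberg–Fujii gaps), and of `ZetaZeroWindowsExplicit.lean` (explicit multiplicity bounds for a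
single zero)).  Label: **RH-FREE** — one unconditional published theorem vendored as a NAMED FACT
(`def … : Prop`, D-0014), one definition (the counting function it is about), and the elementary
PROVED relations of that counting function to the tree's `N(T)`, `N*(T)`, `N_d(T)`.  Nothing here
bears on the truth of RH.

Source: A. Simonič, T. S. Trudgian, C. L. Turnage-Butterbaugh, *Some explicit and unconditional results
on gaps between zeroes of the Riemann zeta-function*, Trans. Amer. Math. Soc. **375** (2022) 3239–3265
(arXiv:2010.10675), Theorem 4 `[corpus:paper:arxiv-2010.10675 p0004]`:

> "Let `N_j(T)` be the number of `ρ` with `0 < γ ≤ T` and multiplicity `j ≥ 1`. Then there exists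
> `T₀ > 0` such that `N_j(T)/N(T) ≤ 1.014 · e^{−6.459·10⁻⁷ j}` for every `j ∈ ℕ` and `T ≥ T₀`."

(Explicit form of Fujii's `N_j(T) ≤ e^{−Aj} N(T)` and of Karatsuba–Korolëv's bound, via explicit
moments of `S(t+h) − S(t)`, §§3–5 of the source; `N(T)` counts with multiplicity.)

* `Literature.NumberTheory.LFunctions.zetaZeroCountOfOrder j T` — `N_j(T)`: the number of DISTINCT zeros `ρ`
  with `0 < Im ρ ≤ T` and multiplicity exactly `j` (the reading fixed by the source's remark (1.5):
  "`N_j(T)/N(T) ≤ (1 − 0.4075)/j` for all `j > 1`" from `N₁(T) ≥ 0.4075 N(T)`, which is the inequality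
  `N₁ + j N_j ≤ N` of distinct zeros of exact multiplicity — proved below as
  `Literature.NumberTheory.LFunctions.zetaZeroCountOfOrder_le_of_simple`).  `N₁ = simpleZeroCount`
  (`zetaZeroCountOfOrder_one`), `N_j ≤ N_d` (`zetaZeroCountOfOrder_le_distinctZeroCount`),
  `j · N_j(T) ≤ N(T)` (`mul_zetaZeroCountOfOrder_le`).
* `Literature.NumberTheory.LFunctions.SimonicTrudgianTurnageButterbaugh2022_thm4` — **Theorem 4** (NAMED FACT).

## References

* A. Simonič, T. S. Trudgian, C. L. Turnage-Butterbaugh, Trans. Amer. Math. Soc. 375 (2022)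
  3239–3265, Thm. 4, (1.5) (arXiv:2010.10675). [SimonicTrudgianTurnageButterbaugh2022]
-/

noncomputable section

open Complex Real

namespace Literature.NumberTheory.LFunctions

/-- `N_j(T)`: the number of distinct zeros `ρ` of `ζ` with `0 < Im ρ ≤ T` and multiplicity exactly `j`
(`m(ρ) = Literature.riemannZetaZeroOrder ρ = j`), the counting function of Simonič–Trudgian–Turnage-Butterbaugh's
Theorem 4 (for `j = 1` it is `Literature.NumberTheory.LFunctions.simpleZeroCount`).
[cite: SimonicTrudgianTurnageButterbaugh2022, §1 Thm. 4] -/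
def zetaZeroCountOfOrder (j : ℕ) (T : ℝ) : ℕ :=
  {ρ ∈ zetaZeroBox 0 T | riemannZetaZeroOrder ρ = j}.ncard

/-- `N₁(T) = N*(T)` (the tree's count of simple zeros). [cite: SimonicTrudgianTurnageButterbaugh2022, §1 (1.5)] -/
theorem zetaZeroCountOfOrder_one (T : ℝ) : zetaZeroCountOfOrder 1 T = simpleZeroCount T := by
  simp [zetaZeroCountOfOrder, simpleZeroCount]

/-- `N_j(T) ≤ N_d(T)` (distinct zeros). [cite: SimonicTrudgianTurnageButterbaugh2022, §1 Thm. 4] -/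
theorem zetaZeroCountOfOrder_le_distinctZeroCount (j : ℕ) (T : ℝ) :
    zetaZeroCountOfOrder j T ≤ distinctZeroCount T :=
  Set.ncard_le_ncard (fun _ h ↦ h.1) (zetaZeroBox_finite 0 T)

/-- The set counted by `N_j(T)` is finite. [cite: SimonicTrudgianTurnageButterbaugh2022, §1 Thm. 4] -/
theorem zetaZeroCountOfOrder_finite (j : ℕ) (T : ℝ) :
    {ρ ∈ zetaZeroBox 0 T | riemannZetaZeroOrder ρ = j}.Finite :=
  (zetaZeroBox_finite 0 T).subset fun _ h ↦ h.1

/-- **`j · N_j(T) ≤ N(T)`**: each of the `N_j(T)` distinct zeros of multiplicity `j` contributes `j`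
to `N(T)`. [cite: SimonicTrudgianTurnageButterbaugh2022, §1 (1.5)] -/
theorem mul_zetaZeroCountOfOrder_le (j : ℕ) (T : ℝ) :
    (j : ℝ) * zetaZeroCountOfOrder j T ≤ zetaZeroCount T := by
  classical
  have hF := zetaZeroCountOfOrder_finite j T
  set S := hF.toFinset with hS
  have hcard : zetaZeroCountOfOrder j T = S.card := by
    rw [zetaZeroCountOfOrder, hS, Set.ncard_eq_toFinset_card _ hF]
  have hsum : ∑ ρ ∈ S, (riemannZetaZeroOrder ρ : ℝ) = (j : ℝ) * S.card := by
    rw [Finset.sum_congr rfl fun ρ hρ ↦ (by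
      rw [hS, Set.Finite.mem_toFinset] at hρ
      rw [hρ.2] : (riemannZetaZeroOrder ρ : ℝ) = (j : ℤ))]
    rw [Finset.sum_const, nsmul_eq_mul]
    push_cast
    ring
  have h := FarZeros.sum_le_zetaZeroCount (T := T) S fun ρ hρ ↦ by
    rw [hS, Set.Finite.mem_toFinset] at hρ
    obtain ⟨⟨h0, -, -, h3, h4⟩, -⟩ := hρ
    exact ⟨h0, h3, h4⟩
  rw [hcard, ← hsum]
  exact h

/-- **The source's (1.5): `N_j(T) ≤ (1 − c) N(T)/j` for `j ≥ 2` whenever `N₁(T) ≥ c N(T)`**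
(simple zeros and zeros of multiplicity `j` are disjoint sets of distinct zeros, contributing
`N₁(T) + j N_j(T) ≤ N(T)`).  With `c = 0.4075` (Pratt–Robles–Zaharescu–Zeindler, eventually) this is
the printed `N_j(T)/N(T) ≤ (1 − 0.4075)/j`. [cite: SimonicTrudgianTurnageButterbaugh2022, §1 (1.5)] -/
theorem zetaZeroCountOfOrder_le_of_simple {c T : ℝ} {j : ℕ} (hj : 2 ≤ j)
    (hc : c * zetaZeroCount T ≤ simpleZeroCount T) :
    (zetaZeroCountOfOrder j T : ℝ) ≤ (1 - c) * zetaZeroCount T / j := by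
  classical
  have hF1 := zetaZeroCountOfOrder_finite 1 T
  have hFj := zetaZeroCountOfOrder_finite j T
  set S₁ := hF1.toFinset with hS₁
  set Sj := hFj.toFinset with hSj
  have hj1 : (1 : ℕ) ≠ j := by omega
  have hdisj : Disjoint S₁ Sj := by
    rw [Finset.disjoint_left]
    intro ρ h1 h2
    rw [hS₁, Set.Finite.mem_toFinset] at h1
    rw [hSj, Set.Finite.mem_toFinset] at h2
    have e1 : riemannZetaZeroOrder ρ = (1 : ℕ) := h1.2
    have e2 : riemannZetaZeroOrder ρ = (j : ℕ) := h2.2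
    exact hj1 (by exact_mod_cast e1.symm.trans e2)
  have hcard1 : simpleZeroCount T = S₁.card := by
    rw [← zetaZeroCountOfOrder_one, zetaZeroCountOfOrder, hS₁, Set.ncard_eq_toFinset_card _ hF1]
  have hcardj : zetaZeroCountOfOrder j T = Sj.card := by
    rw [zetaZeroCountOfOrder, hSj, Set.ncard_eq_toFinset_card _ hFj]
  have hsum1 : ∑ ρ ∈ S₁, (riemannZetaZeroOrder ρ : ℝ) = S₁.card := by
    rw [Finset.sum_congr rfl fun ρ hρ ↦ (by
      rw [hS₁, Set.Finite.mem_toFinset] at hρ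
      have e : riemannZetaZeroOrder ρ = (1 : ℕ) := hρ.2
      rw [e] : (riemannZetaZeroOrder ρ : ℝ) = ((1 : ℕ) : ℤ))]
    rw [Finset.sum_const, nsmul_eq_mul]
    push_cast
    ring
  have hsumj : ∑ ρ ∈ Sj, (riemannZetaZeroOrder ρ : ℝ) = (j : ℝ) * Sj.card := by
    rw [Finset.sum_congr rfl fun ρ hρ ↦ (by
      rw [hSj, Set.Finite.mem_toFinset] at hρ
      rw [hρ.2] : (riemannZetaZeroOrder ρ : ℝ) = (j : ℤ))]
    rw [Finset.sum_const, nsmul_eq_mul]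
    push_cast
    ring
  have h := FarZeros.sum_le_zetaZeroCount (T := T) (S₁ ∪ Sj) fun ρ hρ ↦ by
    rw [Finset.mem_union, hS₁, hSj, Set.Finite.mem_toFinset, Set.Finite.mem_toFinset] at hρ
    rcases hρ with ⟨⟨h0, -, -, h3, h4⟩, -⟩ | ⟨⟨h0, -, -, h3, h4⟩, -⟩
    · exact ⟨h0, h3, h4⟩
    · exact ⟨h0, h3, h4⟩
  rw [Finset.sum_union hdisj, hsum1, hsumj] at h
  rw [hcardj, le_div_iff₀ (by positivity)]
  rw [hcard1] at hc
  nlinarith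

/-! ## Theorem 4 (named fact) -/

/-- NAMED FACT (Simonič–Trudgian–Turnage-Butterbaugh 2022, **Theorem 4**, as printed: "Let `N_j(T)` be
the number of `ρ` with `0 < γ ≤ T` and multiplicity `j ≥ 1`. Then there exists `T₀ > 0` such that
`N_j(T)/N(T) ≤ 1.014 · e^{−6.459·10⁻⁷ j}` for every `j ∈ ℕ` and `T ≥ T₀`."), `T₀` uniform in `j`,
written without the division (`N(T) > 0` for `T ≥ T₀` large anyway).  `N_j = zetaZeroCountOfOrder j`
(distinct zeros of multiplicity exactly `j`, see the module docstring), `N = zetaZeroCount` (with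
multiplicity).  Unconditional; the threshold `T₀` is not made explicit in the source.  Users take
`(h : SimonicTrudgianTurnageButterbaugh2022_thm4)`. [cite: SimonicTrudgianTurnageButterbaugh2022, Thm. 4] -/
def SimonicTrudgianTurnageButterbaugh2022_thm4 : Prop :=
  ∃ T₀ : ℝ, 0 < T₀ ∧ ∀ j : ℕ, 1 ≤ j → ∀ T : ℝ, T₀ ≤ T →
    (zetaZeroCountOfOrder j T : ℝ) ≤ 1.014 * Real.exp (-(6.459e-7 * j)) * zetaZeroCount T

namespace SimonicTrudgianTurnageButterbaugh2022_thm4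

/-- Theorem 4 beats the trivial `N_j ≤ N/j` exactly when `1.014 j e^{−6.459·10⁻⁷ j} < 1`; e.g. for
`j ≥ 3·10⁷` it gives `N_j(T) ≤ 1.014 e^{−19.377} N(T) ≤ 4·10⁻⁹ N(T)`, here in the weaker printed-scale form
`N_j(T) ≤ 10⁻⁸ N(T)` (`e^{19.377} ≥ 1.014·10⁸`). [cite: SimonicTrudgianTurnageButterbaugh2022, Thm. 4 and the remark after (1.5)] -/
theorem large_multiplicity (h : SimonicTrudgianTurnageButterbaugh2022_thm4) :
    ∃ T₀ : ℝ, ∀ j : ℕ, 3 * 10 ^ 7 ≤ j → ∀ T : ℝ, T₀ ≤ T →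
      (zetaZeroCountOfOrder j T : ℝ) ≤ 1e-8 * zetaZeroCount T := by
  obtain ⟨T₀, -, hT₀⟩ := h
  refine ⟨T₀, fun j hj T hT ↦ ?_⟩
  have h1 := hT₀ j (by omega) T hT
  have hN : (0 : ℝ) ≤ zetaZeroCount T := Nat.cast_nonneg _
  have hj' : (3 * 10 ^ 7 : ℝ) ≤ j := by exact_mod_cast hj
  -- `exp(−6.459e−7 j) ≤ exp(−19.377) ≤ 1/(1.014·10⁸)`
  have hexp : Real.exp (-(6.459e-7 * j)) ≤ Real.exp (-19.377) :=
    Real.exp_le_exp.2 (by nlinarith)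
  have he : Real.exp (-19.377 : ℝ) ≤ 1 / (1.014e8) := by
    rw [Real.exp_neg, one_div]
    apply inv_anti₀ (by norm_num)
    have h19 : (1.014e8 : ℝ) ≤ Real.exp 1 ^ 19 := by
      have := Real.exp_one_gt_d9
      calc (1.014e8 : ℝ) ≤ 2.7182818283 ^ 19 := by norm_num
        _ ≤ Real.exp 1 ^ 19 := by gcongr
    calc (1.014e8 : ℝ) ≤ Real.exp 1 ^ 19 := h19
      _ = Real.exp 19 := by rw [Real.exp_one_pow]; norm_num
      _ ≤ Real.exp 19.377 := Real.exp_le_exp.2 (by norm_num)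
  have hc : 1.014 * Real.exp (-(6.459e-7 * j)) ≤ 1e-8 := by
    have := mul_le_mul_of_nonneg_left (hexp.trans he) (by norm_num : (0 : ℝ) ≤ 1.014)
    linarith [show (1.014 : ℝ) * (1 / 1.014e8) ≤ 1e-8 by norm_num]
  calc (zetaZeroCountOfOrder j T : ℝ) ≤ 1.014 * Real.exp (-(6.459e-7 * j)) * zetaZeroCount T := h1
    _ ≤ 1e-8 * zetaZeroCount T := mul_le_mul_of_nonneg_right hc hN

end SimonicTrudgianTurnageButterbaugh2022_thm4

end Literature.NumberTheory.LFunctions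

end
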